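import Summits.HubbardSuperconductivity.HubbardSuperconductivity.Theorems.BcsKacWindowInfraredCompletionReduction

/-!
# Crux `InfraredCompletion` (stmt-HubbardSuperconductivity-1321, route BcsKacWindow), line `birth`:
# zero-mode dominance from the SQRT-SHAPE (skeleton v5 glue — the window bootstrap)

Skeleton v4 of line `birth` reduced the crux to the soft-window FLOOR (stub A) and the pointwise
RELATIVE Goldstone shape with background (stub B2')
`S_ψ(m) · |q_m| · L² ≤ A · S_ψ(0) + B · |q_m| · L²`, whose Goldstone coefficient is proportional
to the condensate `S_ψ(0)` itself — the tight infrared bound (Gaussian domination without reflection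
positivity). This file shows that the Kennedy–Lieb–Shastry composition needs much less. Because the
soft window has radius `ε = Δ(U)/t` with `t → ∞`, a pointwise bound whose Goldstone coefficient is
only the GEOMETRIC MEAN of the relative and the absolute one,

  `S_ψ(m) · |q_m| · L² ≤ A · L · √(S_ψ(0)) + D · Δ(U) · L² + B · |q_m| · L²`   (the "sqrt-shape"),

already forces zero-mode dominance, by a bootstrap: with `x = S_ψ(0)`, the window sum is
`x + tail ≥ F := c_A Δ² L²` (floor) while `tail ≤ P √x + G` with `P = 2A Δ L / t`,
`G = 2D Δ² L²/t + B Δ² L²/t²`; once `P² ≤ F/16` and `G ≤ F/4` (i.e. `t ≥ 64A²/c_A`, `t ≥ 16D/c_A`,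
`t ≥ 8B/c_A`, `t ≥ 1`) this is incompatible with `x < F/4` (`zeroMode_bootstrap`). So
`S_ψ(0) ≥ c_A Δ² L²/4`, i.e. bulk order with `c₁ = c_A/4`.

The sqrt-shape is what the `T = 0` uncertainty (Pitaevskii–Stringari) inequality
`‖Δ_d(q)ψ‖² ≤ √(χ_pair(q) · f(q) / 2)` delivers from an f-sum (double-commutator) bound
`f(q) ≤ C L²` and a pair-susceptibility infrared bound `χ_pair(q) |q|² ≤ S_ψ(0)/ρ₀ + B' |q|² L²`
(phase stiffness), and it is implied by B2' (companion file, via the Parseval ceiling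
`S_ψ(0) ≤ 32 L²`). Contents (no definitions, no named facts, `sorry`-free):

* `zeroMode_bootstrap` — the real-arithmetic bootstrap;
* `pairStructureFactor_le_of_shapeConst`, `softWindowTail_of_shapeConst` — the pointwise step and
  the tail bound `Σ_{m ≠ 0, |q_m|² ≤ ε²} S_ψ(m) ≤ 2εΦ + B ε² L²` for a shape
  `S_ψ(m)|q_m|L² ≤ Φ + B|q_m|L²` with ANY constant `Φ ≥ 0` (lattice sums `latWindowSum_le`,
  `card_softWindow_le`);
* `bulk_of_floor_of_sqrtShape` — one datum: floor + sqrt-shape ⇒ the crux's consequent;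
* `infraredCompletion_of_floor_of_sqrtShape` — stub A → stub B3 (sqrt-shape) → the crux body
  (verbatim, inlined: this module does not import the route file);
* (companion file `BcsKacWindowInfraredCompletionSqrtShapeOfShapeBg.lean`: `S_ψ(m) ≤ 32 L²` for a
  normalised vector, hence B2' ⇒ B3 with `(A, D, B) ↦ (A√32, 0, B)`.)

Sources: T. Kennedy, E. H. Lieb, B. S. Shastry, PRL **61** (1988) 2582 (sum rule minus infrared
bound); L. Pitaevskii, S. Stringari, J. Low Temp. Phys. **85** (1991) 377 (the `T = 0` uncertainty
inequality `m₀² ≤ m₁ m₋₁` behind the sqrt-shape). Lead c15, 2026-08-17. [folklore]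
-/

noncomputable section

-- the mandated namespace `Summit.<Summit>.<Problem>.Theorems…` repeats `HubbardSuperconductivity`
-- (single-problem summit, D-0017), which the `dupNamespace` linter flags on every declaration
set_option linter.dupNamespace false

namespace Summit.HubbardSuperconductivity.HubbardSuperconductivity.Theorems.InfraredCompletion

open Literature.MathematicalPhysics.QuantumLattice Literature.Probability.LatticeModels
open Summit.HubbardSuperconductivity.HubbardSuperconductivity.Theorems.WcbcsSsbToTorusLRO
  (latWindowSum_le)
open scoped Matrix

/-! ### The bootstrap -/

/-- **Zero-mode bootstrap** (pure real arithmetic). If `x ≥ 0`, `F ≤ x + T`,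
`T ≤ P √x + G` with `G ≤ F/4` and `P² ≤ F/16`, then `F/4 ≤ x`: otherwise `x < F/4`
forces `F > 0`, `T > 3F/4`, `P √x > F/2`, hence `F²/4 < P² x ≤ (F/16)(F/4)`, absurd.
This is why an `O(√order)` Goldstone coefficient suffices on a window of radius `Δ(U)/t`.
[folklore] -/
theorem zeroMode_bootstrap {x T F P G : ℝ} (hx : 0 ≤ x) (hsum : F ≤ x + T)
    (htail : T ≤ P * Real.sqrt x + G) (hG : G ≤ F / 4) (hP2 : P ^ 2 ≤ F / 16) : F / 4 ≤ x := by
  by_contra h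
  push Not at h
  have hF : 0 < F := by linarith
  have hsx : 0 ≤ Real.sqrt x := Real.sqrt_nonneg x
  have hsq : Real.sqrt x * Real.sqrt x = x := Real.mul_self_sqrt hx
  have h1 : F / 2 < P * Real.sqrt x := by linarith
  have h2 : F / 2 * (F / 2) < P * Real.sqrt x * (P * Real.sqrt x) :=
    mul_self_lt_mul_self (by linarith) h1
  have h3 : P * Real.sqrt x * (P * Real.sqrt x) = P ^ 2 * x := by
    calc P * Real.sqrt x * (P * Real.sqrt x) = P ^ 2 * (Real.sqrt x * Real.sqrt x) := by ring
      _ = P ^ 2 * x := by rw [hsq]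
  rw [h3] at h2
  have h4 : P ^ 2 * x ≤ F / 16 * x := mul_le_mul_of_nonneg_right hP2 hx
  nlinarith

/-! ### The tail of a shape with a constant Goldstone term (any vector, no physics) -/

/-- **Pointwise step.** If `m ≠ 0` and `S_ψ(m) · |q_m| · L² ≤ Φ + B · |q_m| · L²`, then
`S_ψ(m) ≤ (Φ / L²) · |q_m|⁻¹ + B` (`|q_m| > 0` for `m ≠ 0`, `momentumNormSq_eq_zero_iff`).
[folklore] -/
theorem pairStructureFactor_le_of_shapeConst {L : ℕ} [NeZero L]
    (ψ : Fock (Orb (FermionTorus 2 L))) (Φ B : ℝ) {m : Fin 2 → ZMod L} (hm : m ≠ 0)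
    (h : pairStructureFactor dWaveFormFactor L ψ m * Real.sqrt (momentumNormSq L m) * (L : ℝ) ^ 2 ≤
      Φ + B * Real.sqrt (momentumNormSq L m) * (L : ℝ) ^ 2) :
    pairStructureFactor dWaveFormFactor L ψ m ≤
      Φ / (L : ℝ) ^ 2 * (1 / Real.sqrt (momentumNormSq L m)) + B := by
  have hL : (0 : ℝ) < (L : ℝ) := Nat.cast_pos.2 (Nat.pos_of_ne_zero (NeZero.ne L))
  have hL2 : (0 : ℝ) < (L : ℝ) ^ 2 := by positivity
  have hq : 0 < momentumNormSq L m :=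
    lt_of_le_of_ne (momentumNormSq_nonneg m)
      (fun h0 => hm ((momentumNormSq_eq_zero_iff m).1 h0.symm))
  have hsq : 0 < Real.sqrt (momentumNormSq L m) := Real.sqrt_pos.2 hq
  rw [← sub_le_iff_le_add, mul_one_div, le_div_iff₀ hsq, le_div_iff₀ hL2]
  nlinarith [h]

/-- **Tail bound for a shape with a constant Goldstone term.** For every side `L ≥ 1`, every Fock
vector `ψ`, all `Φ, B ≥ 0` and every window radius `ε > 0`: if
`S_ψ(m) · |q_m| · L² ≤ Φ + B · |q_m| · L²` for all `m ≠ 0` with `|q_m|² ≤ ε²`, then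
`Σ_{m ≠ 0, |q_m|² ≤ ε²} S_ψ(m) ≤ 2εΦ + B ε² L²`: sum the pointwise step; the `|q_m|⁻¹` part is
`≤ (Φ/L²) · 2ε L²` (`latWindowSum_le`, radius `2ε`), the background part `≤ B · #window ≤ B ε² L²`
(`card_softWindow_le`). Kennedy–Lieb–Shastry, PRL 61 (1988) 2582 (lattice-sum bookkeeping of the
infrared bound). [folklore] -/
theorem softWindowTail_of_shapeConst (L : ℕ) [NeZero L] (ψ : Fock (Orb (FermionTorus 2 L)))
    (Φ B ε : ℝ) (hΦ : 0 ≤ Φ) (hB : 0 ≤ B) (hε : 0 < ε)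
    (hshape : ∀ m : Fin 2 → ZMod L, m ≠ 0 → momentumNormSq L m ≤ ε ^ 2 →
      pairStructureFactor dWaveFormFactor L ψ m * Real.sqrt (momentumNormSq L m) * (L : ℝ) ^ 2 ≤
        Φ + B * Real.sqrt (momentumNormSq L m) * (L : ℝ) ^ 2) :
    ∑ m ∈ Finset.univ.filter
        (fun m : Fin 2 → ZMod L => m ≠ 0 ∧ momentumNormSq L m ≤ ε ^ 2),
      pairStructureFactor dWaveFormFactor L ψ m ≤ 2 * ε * Φ + B * ε ^ 2 * (L : ℝ) ^ 2 := by
  have hL : (0 : ℝ) < (L : ℝ) := Nat.cast_pos.2 (Nat.pos_of_ne_zero (NeZero.ne L))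
  have hL2 : (0 : ℝ) < (L : ℝ) ^ 2 := by positivity
  have hK : 0 ≤ Φ / (L : ℝ) ^ 2 := div_nonneg hΦ hL2.le
  set T : Finset (Fin 2 → ZMod L) :=
    Finset.univ.filter fun m : Fin 2 → ZMod L => m ≠ 0 ∧ momentumNormSq L m ≤ ε ^ 2 with hTdef
  have hpt : ∀ m ∈ T, pairStructureFactor dWaveFormFactor L ψ m ≤
      Φ / (L : ℝ) ^ 2 * (1 / Real.sqrt (momentumNormSq L m)) + B := by
    intro m hm
    obtain ⟨hm0, hmε⟩ := (Finset.mem_filter.1 hm).2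
    exact pairStructureFactor_le_of_shapeConst ψ Φ B hm0 (hshape m hm0 hmε)
  have hsub : T ⊆ Finset.univ.filter
      (fun m : TorusSite 2 L => m ≠ 0 ∧ momentumNormSq L m < (2 * ε) ^ 2) := by
    intro m hm
    obtain ⟨hm0, hmε⟩ := (Finset.mem_filter.1 hm).2
    refine Finset.mem_filter.2 ⟨Finset.mem_univ _, hm0, lt_of_le_of_lt hmε ?_⟩
    nlinarith
  have h2ε : 0 < 2 * ε := by positivity
  have hinv : ∑ m ∈ T, 1 / Real.sqrt (momentumNormSq L m) ≤ (2 * ε) * (L : ℝ) ^ 2 :=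
    le_trans (Finset.sum_le_sum_of_subset_of_nonneg hsub (fun m _ _ => by positivity))
      (latWindowSum_le L (2 * ε) h2ε)
  have hcard : ((T.card : ℕ) : ℝ) ≤ ε ^ 2 * (L : ℝ) ^ 2 := by
    have h := card_softWindow_le L ε hε
    have h' : ε ^ 2 * (L : ℝ) ^ 2 / 3 ≤ ε ^ 2 * (L : ℝ) ^ 2 := by
      rw [div_le_iff₀ (by norm_num : (0 : ℝ) < 3)]
      nlinarith [sq_nonneg (ε * (L : ℝ))]
    exact le_trans h h'
  calc ∑ m ∈ T, pairStructureFactor dWaveFormFactor L ψ m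
      ≤ ∑ m ∈ T, (Φ / (L : ℝ) ^ 2 * (1 / Real.sqrt (momentumNormSq L m)) + B) :=
        Finset.sum_le_sum hpt
    _ = Φ / (L : ℝ) ^ 2 * (∑ m ∈ T, 1 / Real.sqrt (momentumNormSq L m)) +
          ((T.card : ℕ) : ℝ) * B := by
        rw [Finset.sum_add_distrib, Finset.mul_sum, Finset.sum_const, nsmul_eq_mul]
    _ ≤ Φ / (L : ℝ) ^ 2 * ((2 * ε) * (L : ℝ) ^ 2) + (ε ^ 2 * (L : ℝ) ^ 2) * B :=
        add_le_add (mul_le_mul_of_nonneg_left hinv hK) (mul_le_mul_of_nonneg_right hcard hB)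
    _ = 2 * ε * Φ + B * ε ^ 2 * (L : ℝ) ^ 2 := by
        field_simp

/-! ### Floor + sqrt-shape ⇒ bulk order -/

/-- **KLS arithmetic on the corner with the sqrt-shape, one datum** (`sorry`-free). For the datum
`(a, b, Δ)` with `Δ(U) > 0`: a soft-window FLOOR (stub A's conclusion: `c_A, s_A, U_A(t)`) and the
SQRT-SHAPE (stub B3's conclusion: `A, D, B, t₀, U_R`) give the crux's consequent with `c₁ = c_A/4`,
`s₁ = t := max (max s_A t₀) (max 1 (64A²/c_A + 16D/c_A + 8B/c_A))`, `U₁ = min U_A(t) U_R`.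
On a bulk torus `t ≤ Δ(U)·L`: `0 ∈ W_t` so `Σ_{W_t} S = S(0) + tail ≥ c_A Δ² L²` (floor); the
`t`-window lies in the `t₀`-window, so the sqrt-shape and `softWindowTail_of_shapeConst`
(`Φ = A L √S(0) + D Δ L²`, `ε = Δ/t`) give `tail ≤ (2AΔL/t) √S(0) + 2DΔ²L²/t + BΔ²L²/t²`;
`zeroMode_bootstrap` yields `S(0) ≥ c_A Δ² L²/4`, and `S(0) = Re⟨ψ, Δ_d†Δ_d ψ⟩/L²`
(`pairStructureFactor_zero`). Kennedy–Lieb–Shastry, PRL 61 (1988) 2582; Pitaevskii–Stringari,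
JLTP 85 (1991) 377. [folklore] -/
theorem bulk_of_floor_of_sqrtShape (a b : ℝ) (Δ : ℝ → ℝ) (hΔ : ∀ U : ℝ, 0 < U → 0 < Δ U)
    (hfloor : ∃ cA sA : ℝ, 0 < cA ∧ ∀ t : ℝ, sA ≤ t → ∃ UA : ℝ, 0 < UA ∧
        ∀ δ ∈ Set.Icc a b, ∀ U ∈ Set.Ioo (0:ℝ) UA, ∀ (L : ℕ) [NeZero L], Even L → t ≤ Δ U * L →
          ∀ ψ : Fock (Orb (FermionTorus 2 L)), star ψ ⬝ᵥ ψ = 1 →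
            IsGroundStateInSector (hubbardTorus 2 L 1 U) (2 * ⌊(1 - δ) * (L : ℝ) ^ 2 / 2⌋₊) 0 ψ →
              cA * Δ U ^ 2 * (L : ℝ) ^ 2 ≤
                ∑ m ∈ Finset.univ.filter
                    (fun m : Fin 2 → ZMod L => momentumNormSq L m ≤ (Δ U / t) ^ 2),
                  pairStructureFactor dWaveFormFactor L ψ m)
    (hshape : ∃ A D B t₀ UR : ℝ, 0 ≤ A ∧ 0 ≤ D ∧ 0 ≤ B ∧ 0 < t₀ ∧ 0 < UR ∧
        ∀ δ ∈ Set.Icc a b, ∀ U ∈ Set.Ioo (0:ℝ) UR, ∀ (L : ℕ) [NeZero L], Even L → t₀ ≤ Δ U * L →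
          ∀ ψ : Fock (Orb (FermionTorus 2 L)), star ψ ⬝ᵥ ψ = 1 →
            IsGroundStateInSector (hubbardTorus 2 L 1 U) (2 * ⌊(1 - δ) * (L : ℝ) ^ 2 / 2⌋₊) 0 ψ →
              ∀ m : Fin 2 → ZMod L, m ≠ 0 → momentumNormSq L m ≤ (Δ U / t₀) ^ 2 →
                pairStructureFactor dWaveFormFactor L ψ m * Real.sqrt (momentumNormSq L m) *
                    (L : ℝ) ^ 2 ≤
                  A * (L : ℝ) * Real.sqrt (pairStructureFactor dWaveFormFactor L ψ 0) +
                    D * Δ U * (L : ℝ) ^ 2 +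
                      B * Real.sqrt (momentumNormSq L m) * (L : ℝ) ^ 2) :
    ∃ c₁ s₁ U₁ : ℝ, 0 < c₁ ∧ 0 < U₁ ∧ ∀ δ ∈ Set.Icc a b, ∀ U ∈ Set.Ioo (0:ℝ) U₁,
      ∀ (L : ℕ) [NeZero L], Even L → s₁ ≤ Δ U * L →
        ∀ ψ : Fock (Orb (FermionTorus 2 L)), star ψ ⬝ᵥ ψ = 1 →
          IsGroundStateInSector (hubbardTorus 2 L 1 U) (2 * ⌊(1 - δ) * (L : ℝ) ^ 2 / 2⌋₊) 0 ψ →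
            c₁ * Δ U ^ 2 ≤ (expect ((pairField dWaveFormFactor L)ᴴ * pairField dWaveFormFactor L)
              ψ).re / (L : ℝ) ^ 4 := by
  obtain ⟨cA, sA, hcA, hfl⟩ := hfloor
  obtain ⟨A, D, B, t₀, UR, hA, hD, hB, ht₀, hUR, hsh⟩ := hshape
  set t : ℝ := max (max sA t₀) (max 1 (64 * A ^ 2 / cA + 16 * D / cA + 8 * B / cA)) with htdef
  have hsAt : sA ≤ t := le_trans (le_max_left _ _) (le_max_left _ _)
  have ht₀t : t₀ ≤ t := le_trans (le_max_right _ _) (le_max_left _ _)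
  have ht1 : 1 ≤ t := le_trans (le_max_left _ _) (le_max_right _ _)
  have htc : 64 * A ^ 2 / cA + 16 * D / cA + 8 * B / cA ≤ t :=
    le_trans (le_max_right _ _) (le_max_right _ _)
  have htpos : 0 < t := lt_of_lt_of_le one_pos ht1
  clear_value t
  have hAc : 0 ≤ 64 * A ^ 2 / cA := by positivity
  have hDc : 0 ≤ 16 * D / cA := by positivity
  have hBc : 0 ≤ 8 * B / cA := by positivity
  have h64 : 64 * A ^ 2 ≤ cA * t := by
    have h : 64 * A ^ 2 / cA ≤ t := by linarith only [htc, hDc, hBc]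
    rw [div_le_iff₀ hcA] at h
    calc 64 * A ^ 2 ≤ t * cA := h
      _ = cA * t := mul_comm t cA
  have h16 : 16 * D ≤ cA * t := by
    have h : 16 * D / cA ≤ t := by linarith only [htc, hAc, hBc]
    rw [div_le_iff₀ hcA] at h
    calc 16 * D ≤ t * cA := h
      _ = cA * t := mul_comm t cA
  have h8 : 8 * B ≤ cA * t := by
    have h : 8 * B / cA ≤ t := by linarith only [htc, hAc, hDc]
    rw [div_le_iff₀ hcA] at h
    calc 8 * B ≤ t * cA := h
      _ = cA * t := mul_comm t cA
  obtain ⟨UA, hUA, hflt⟩ := hfl t hsAt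
  refine ⟨cA / 4, t, min UA UR, by positivity, lt_min hUA hUR, ?_⟩
  intro δ hδ U hU L _ hL htL ψ hψ hGS
  have hUA' : U ∈ Set.Ioo (0:ℝ) UA := ⟨hU.1, lt_of_lt_of_le hU.2 (min_le_left _ _)⟩
  have hUR' : U ∈ Set.Ioo (0:ℝ) UR := ⟨hU.1, lt_of_lt_of_le hU.2 (min_le_right _ _)⟩
  have hΔpos : 0 < Δ U := hΔ U hU.1
  have hε : 0 < Δ U / t := div_pos hΔpos htpos
  have hL0 : (0 : ℝ) < (L : ℝ) := Nat.cast_pos.2 (Nat.pos_of_ne_zero (NeZero.ne L))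
  have hL2 : (0 : ℝ) < (L : ℝ) ^ 2 := by positivity
  -- the `t`-window lies inside the `t₀`-window
  have hwin : ∀ m : Fin 2 → ZMod L, momentumNormSq L m ≤ (Δ U / t) ^ 2 →
      momentumNormSq L m ≤ (Δ U / t₀) ^ 2 := by
    intro m hm
    refine le_trans hm (pow_le_pow_left₀ hε.le ?_ 2)
    exact div_le_div_of_nonneg_left hΔpos.le ht₀ ht₀t
  have hbulk₀ : t₀ ≤ Δ U * L := le_trans ht₀t htL
  -- notation: the structure factor, the soft window and its tail
  set S : (Fin 2 → ZMod L) → ℝ := fun m => pairStructureFactor dWaveFormFactor L ψ m with hS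
  set W : Finset (Fin 2 → ZMod L) :=
    Finset.univ.filter (fun m : Fin 2 → ZMod L => momentumNormSq L m ≤ (Δ U / t) ^ 2) with hWdef
  set Tl : Finset (Fin 2 → ZMod L) :=
    Finset.univ.filter (fun m : Fin 2 → ZMod L => m ≠ 0 ∧ momentumNormSq L m ≤ (Δ U / t) ^ 2)
    with hTdef
  have hx : 0 ≤ S 0 := pairStructureFactor_nonneg _ _ _ _
  have hsx : 0 ≤ Real.sqrt (S 0) := Real.sqrt_nonneg _
  have h0W : (0 : Fin 2 → ZMod L) ∈ W := by
    rw [hWdef, Finset.mem_filter]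
    exact ⟨Finset.mem_univ _, by rw [momentumNormSq_zero]; positivity⟩
  have hsplit : ∑ m ∈ W, S m = S 0 + ∑ m ∈ Tl, S m := by
    rw [← Finset.add_sum_erase W S h0W]
    congr 1
    apply Finset.sum_congr _ (fun _ _ => rfl)
    ext m
    simp only [hWdef, hTdef, Finset.mem_erase, Finset.mem_filter, Finset.mem_univ, true_and]
  -- the floor and the tail bound
  have hflo : cA * Δ U ^ 2 * (L : ℝ) ^ 2 ≤ ∑ m ∈ W, S m := hflt δ hδ U hUA' L hL htL ψ hψ hGS
  have hΦ : 0 ≤ A * (L : ℝ) * Real.sqrt (S 0) + D * Δ U * (L : ℝ) ^ 2 := by positivity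
  have htail : ∑ m ∈ Tl, S m ≤
      2 * (Δ U / t) * (A * (L : ℝ) * Real.sqrt (S 0) + D * Δ U * (L : ℝ) ^ 2) +
        B * (Δ U / t) ^ 2 * (L : ℝ) ^ 2 :=
    softWindowTail_of_shapeConst L ψ _ B (Δ U / t) hΦ hB hε
      (fun m hm0 hm => hsh δ hδ U hUR' L hL hbulk₀ ψ hψ hGS m hm0 (hwin m hm))
  -- bootstrap data: `tail ≤ P √x + G`
  have htail' : ∑ m ∈ Tl, S m ≤
      (2 * A * Δ U * (L : ℝ) / t) * Real.sqrt (S 0) +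
        (2 * D * Δ U ^ 2 * (L : ℝ) ^ 2 / t + B * Δ U ^ 2 * (L : ℝ) ^ 2 / t ^ 2) := by
    calc ∑ m ∈ Tl, S m
        ≤ 2 * (Δ U / t) * (A * (L : ℝ) * Real.sqrt (S 0) + D * Δ U * (L : ℝ) ^ 2) +
            B * (Δ U / t) ^ 2 * (L : ℝ) ^ 2 := htail
      _ = (2 * A * Δ U * (L : ℝ) / t) * Real.sqrt (S 0) +
            (2 * D * Δ U ^ 2 * (L : ℝ) ^ 2 / t + B * Δ U ^ 2 * (L : ℝ) ^ 2 / t ^ 2) := by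
          field_simp
          ring
  have hM : 0 < Δ U ^ 2 * (L : ℝ) ^ 2 := by positivity
  have htt : cA * t ≤ cA * t ^ 2 := by
    refine mul_le_mul_of_nonneg_left ?_ hcA.le
    nlinarith only [ht1]
  have hG : 2 * D * Δ U ^ 2 * (L : ℝ) ^ 2 / t + B * Δ U ^ 2 * (L : ℝ) ^ 2 / t ^ 2 ≤
      cA * Δ U ^ 2 * (L : ℝ) ^ 2 / 4 := by
    have hG1 : 2 * D * Δ U ^ 2 * (L : ℝ) ^ 2 / t ≤ cA * Δ U ^ 2 * (L : ℝ) ^ 2 / 8 := by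
      rw [div_le_iff₀ htpos]
      have h : 2 * D * (Δ U ^ 2 * (L : ℝ) ^ 2) ≤ cA * t / 8 * (Δ U ^ 2 * (L : ℝ) ^ 2) :=
        mul_le_mul_of_nonneg_right (by linarith only [h16]) hM.le
      calc 2 * D * Δ U ^ 2 * (L : ℝ) ^ 2 = 2 * D * (Δ U ^ 2 * (L : ℝ) ^ 2) := by ring
        _ ≤ cA * t / 8 * (Δ U ^ 2 * (L : ℝ) ^ 2) := h
        _ = cA * Δ U ^ 2 * (L : ℝ) ^ 2 / 8 * t := by ring
    have hG2 : B * Δ U ^ 2 * (L : ℝ) ^ 2 / t ^ 2 ≤ cA * Δ U ^ 2 * (L : ℝ) ^ 2 / 8 := by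
      rw [div_le_iff₀ (by positivity)]
      have h : B * (Δ U ^ 2 * (L : ℝ) ^ 2) ≤ cA * t ^ 2 / 8 * (Δ U ^ 2 * (L : ℝ) ^ 2) :=
        mul_le_mul_of_nonneg_right (by linarith only [h8, htt]) hM.le
      calc B * Δ U ^ 2 * (L : ℝ) ^ 2 = B * (Δ U ^ 2 * (L : ℝ) ^ 2) := by ring
        _ ≤ cA * t ^ 2 / 8 * (Δ U ^ 2 * (L : ℝ) ^ 2) := h
        _ = cA * Δ U ^ 2 * (L : ℝ) ^ 2 / 8 * t ^ 2 := by ring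
    calc 2 * D * Δ U ^ 2 * (L : ℝ) ^ 2 / t + B * Δ U ^ 2 * (L : ℝ) ^ 2 / t ^ 2
        ≤ cA * Δ U ^ 2 * (L : ℝ) ^ 2 / 8 + cA * Δ U ^ 2 * (L : ℝ) ^ 2 / 8 := add_le_add hG1 hG2
      _ = cA * Δ U ^ 2 * (L : ℝ) ^ 2 / 4 := by ring
  have hP2 : (2 * A * Δ U * (L : ℝ) / t) ^ 2 ≤ cA * Δ U ^ 2 * (L : ℝ) ^ 2 / 16 := by
    rw [div_pow, div_le_iff₀ (by positivity)]
    have h : 4 * A ^ 2 * (Δ U ^ 2 * (L : ℝ) ^ 2) ≤ cA * t ^ 2 / 16 * (Δ U ^ 2 * (L : ℝ) ^ 2) :=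
      mul_le_mul_of_nonneg_right (by linarith only [h64, htt]) hM.le
    calc (2 * A * Δ U * (L : ℝ)) ^ 2 = 4 * A ^ 2 * (Δ U ^ 2 * (L : ℝ) ^ 2) := by ring
      _ ≤ cA * t ^ 2 / 16 * (Δ U ^ 2 * (L : ℝ) ^ 2) := h
      _ = cA * Δ U ^ 2 * (L : ℝ) ^ 2 / 16 * t ^ 2 := by ring
  have hsum : cA * Δ U ^ 2 * (L : ℝ) ^ 2 ≤ S 0 + ∑ m ∈ Tl, S m := by rw [← hsplit]; exact hflo
  have hboot := zeroMode_bootstrap hx hsum htail' hG hP2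
  -- `S 0 = Re⟨ψ, Δ_d† Δ_d ψ⟩ / L²`
  have hzero : S 0 = (expect ((pairField dWaveFormFactor L)ᴴ * pairField dWaveFormFactor L) ψ).re /
      (L : ℝ) ^ 2 := by
    rw [hS]
    exact pairStructureFactor_zero dWaveFormFactor L ψ
  rw [hzero, le_div_iff₀ hL2] at hboot
  rw [le_div_iff₀ (by positivity : (0 : ℝ) < (L : ℝ) ^ 4)]
  calc cA / 4 * Δ U ^ 2 * (L : ℝ) ^ 4 = cA * Δ U ^ 2 * (L : ℝ) ^ 2 / 4 * (L : ℝ) ^ 2 := by ring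
    _ ≤ _ := hboot

/-- **The reduction of the crux to stub A and the sqrt-shape stub B3** (`sorry`-free, no unproved
input): the statement of stub A (soft-window floor) → the statement of stub B3 (sqrt-shape on the
soft window) → the body of `Summit.HubbardSuperconductivity.HubbardSuperconductivity.Theses.
BcsKacWindow.InfraredCompletion`, verbatim (inlined so that this module need not import the route
file). For each datum: stub A gives the floor, stub B3 the sqrt-shape, the flat pin gives
`Δ(U) > 0`, and `bulk_of_floor_of_sqrtShape` concludes (`c₁ = c_A/4`).
Kennedy–Lieb–Shastry, PRL 61 (1988) 2582; Pitaevskii–Stringari, JLTP 85 (1991) 377. [folklore] -/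
theorem infraredCompletion_of_floor_of_sqrtShape :
    (∀ (a b κ₁ κ₂ c₀ s₀ : ℝ) (Δ : ℝ → ℝ), 0 < a → a < b → b < 1 / 2 → 0 < κ₁ → κ₁ ≤ κ₂ →
      0 < c₀ → 0 < s₀ →
      (∀ U : ℝ, 0 < U → Real.exp (-(κ₂ / U ^ 2)) ≤ Δ U ∧ Δ U ≤ Real.exp (-(κ₁ / U ^ 2))) →
      (∀ s : ℝ, s₀ ≤ s → ∃ U₁ : ℝ, 0 < U₁ ∧ ∀ δ ∈ Set.Icc a b, ∀ U ∈ Set.Ioo (0:ℝ) U₁,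
        ∀ (L : ℕ) [NeZero L], Even L → s₀ ≤ Δ U * L → Δ U * L ≤ s →
          ∀ ψ : Fock (Orb (FermionTorus 2 L)), star ψ ⬝ᵥ ψ = 1 →
            IsGroundStateInSector (hubbardTorus 2 L 1 U) (2 * ⌊(1 - δ) * (L : ℝ) ^ 2 / 2⌋₊) 0 ψ →
              c₀ * Δ U ^ 2 ≤ (expect ((pairField dWaveFormFactor L)ᴴ * pairField dWaveFormFactor L)
                ψ).re / (L : ℝ) ^ 4) →
      ∃ cA sA : ℝ, 0 < cA ∧ ∀ t : ℝ, sA ≤ t → ∃ UA : ℝ, 0 < UA ∧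
        ∀ δ ∈ Set.Icc a b, ∀ U ∈ Set.Ioo (0:ℝ) UA, ∀ (L : ℕ) [NeZero L], Even L → t ≤ Δ U * L →
          ∀ ψ : Fock (Orb (FermionTorus 2 L)), star ψ ⬝ᵥ ψ = 1 →
            IsGroundStateInSector (hubbardTorus 2 L 1 U) (2 * ⌊(1 - δ) * (L : ℝ) ^ 2 / 2⌋₊) 0 ψ →
              cA * Δ U ^ 2 * (L : ℝ) ^ 2 ≤
                ∑ m ∈ Finset.univ.filter
                    (fun m : Fin 2 → ZMod L => momentumNormSq L m ≤ (Δ U / t) ^ 2),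
                  pairStructureFactor dWaveFormFactor L ψ m) →
    (∀ (a b κ₁ κ₂ c₀ s₀ : ℝ) (Δ : ℝ → ℝ), 0 < a → a < b → b < 1 / 2 → 0 < κ₁ → κ₁ ≤ κ₂ →
      0 < c₀ → 0 < s₀ →
      (∀ U : ℝ, 0 < U → Real.exp (-(κ₂ / U ^ 2)) ≤ Δ U ∧ Δ U ≤ Real.exp (-(κ₁ / U ^ 2))) →
      (∀ s : ℝ, s₀ ≤ s → ∃ U₁ : ℝ, 0 < U₁ ∧ ∀ δ ∈ Set.Icc a b, ∀ U ∈ Set.Ioo (0:ℝ) U₁,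
        ∀ (L : ℕ) [NeZero L], Even L → s₀ ≤ Δ U * L → Δ U * L ≤ s →
          ∀ ψ : Fock (Orb (FermionTorus 2 L)), star ψ ⬝ᵥ ψ = 1 →
            IsGroundStateInSector (hubbardTorus 2 L 1 U) (2 * ⌊(1 - δ) * (L : ℝ) ^ 2 / 2⌋₊) 0 ψ →
              c₀ * Δ U ^ 2 ≤ (expect ((pairField dWaveFormFactor L)ᴴ * pairField dWaveFormFactor L)
                ψ).re / (L : ℝ) ^ 4) →
      ∃ A D B t₀ UR : ℝ, 0 ≤ A ∧ 0 ≤ D ∧ 0 ≤ B ∧ 0 < t₀ ∧ 0 < UR ∧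
        ∀ δ ∈ Set.Icc a b, ∀ U ∈ Set.Ioo (0:ℝ) UR, ∀ (L : ℕ) [NeZero L], Even L → t₀ ≤ Δ U * L →
          ∀ ψ : Fock (Orb (FermionTorus 2 L)), star ψ ⬝ᵥ ψ = 1 →
            IsGroundStateInSector (hubbardTorus 2 L 1 U) (2 * ⌊(1 - δ) * (L : ℝ) ^ 2 / 2⌋₊) 0 ψ →
              ∀ m : Fin 2 → ZMod L, m ≠ 0 → momentumNormSq L m ≤ (Δ U / t₀) ^ 2 →
                pairStructureFactor dWaveFormFactor L ψ m * Real.sqrt (momentumNormSq L m) *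
                    (L : ℝ) ^ 2 ≤
                  A * (L : ℝ) * Real.sqrt (pairStructureFactor dWaveFormFactor L ψ 0) +
                    D * Δ U * (L : ℝ) ^ 2 +
                      B * Real.sqrt (momentumNormSq L m) * (L : ℝ) ^ 2) →
    ∀ (a b κ₁ κ₂ c₀ s₀ : ℝ) (Δ : ℝ → ℝ), 0 < a → a < b → b < 1 / 2 → 0 < κ₁ → κ₁ ≤ κ₂ → 0 < c₀ →
      0 < s₀ → (∀ U : ℝ, 0 < U → Real.exp (-(κ₂ / U ^ 2)) ≤ Δ U ∧ Δ U ≤ Real.exp (-(κ₁ / U ^ 2))) →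
      (∀ s : ℝ, s₀ ≤ s → ∃ U₁ : ℝ, 0 < U₁ ∧ ∀ δ ∈ Set.Icc a b, ∀ U ∈ Set.Ioo (0:ℝ) U₁,
        ∀ (L : ℕ) [NeZero L], Even L → s₀ ≤ Δ U * L → Δ U * L ≤ s →
          ∀ ψ : Fock (Orb (FermionTorus 2 L)), star ψ ⬝ᵥ ψ = 1 →
            IsGroundStateInSector (hubbardTorus 2 L 1 U) (2 * ⌊(1 - δ) * (L : ℝ) ^ 2 / 2⌋₊) 0 ψ →
              c₀ * Δ U ^ 2 ≤ (expect ((pairField dWaveFormFactor L)ᴴ * pairField dWaveFormFactor L)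
                ψ).re / (L : ℝ) ^ 4) →
      ∃ c₁ s₁ U₁ : ℝ, 0 < c₁ ∧ 0 < U₁ ∧ ∀ δ ∈ Set.Icc a b, ∀ U ∈ Set.Ioo (0:ℝ) U₁,
        ∀ (L : ℕ) [NeZero L], Even L → s₁ ≤ Δ U * L →
          ∀ ψ : Fock (Orb (FermionTorus 2 L)), star ψ ⬝ᵥ ψ = 1 →
            IsGroundStateInSector (hubbardTorus 2 L 1 U) (2 * ⌊(1 - δ) * (L : ℝ) ^ 2 / 2⌋₊) 0 ψ →
              c₁ * Δ U ^ 2 ≤ (expect ((pairField dWaveFormFactor L)ᴴ * pairField dWaveFormFactor L)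
                ψ).re / (L : ℝ) ^ 4 := by
  intro hA hB a b κ₁ κ₂ c₀ s₀ Δ ha hab hb hκ₁ hκ₁₂ hc₀ hs₀ hpin hW
  exact bulk_of_floor_of_sqrtShape a b Δ
    (fun U hU => lt_of_lt_of_le (Real.exp_pos _) (hpin U hU).1)
    (hA a b κ₁ κ₂ c₀ s₀ Δ ha hab hb hκ₁ hκ₁₂ hc₀ hs₀ hpin hW)
    (hB a b κ₁ κ₂ c₀ s₀ Δ ha hab hb hκ₁ hκ₁₂ hc₀ hs₀ hpin hW)

end Summit.HubbardSuperconductivity.HubbardSuperconductivity.Theorems.InfraredCompletion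

end
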